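import Literature.Computability.AlgebraicComplexity.StandardFamiliesProofs
import Summits.ValiantsHypothesis.ValiantsHypothesis.Theorems.RigidityForcesSymmetryGrenetFirstOrderRankRigidConstGauge

/-!
# Route RigidityForcesSymmetry — `GrenetFirstOrderRankRigid` (item stmt-ValiantsHypothesis-21029),
line `grenet_gauge`: stub `stub_linearRigid`, step 3 — the adjugate of Grenet's matrix in path form

For the crux line `Cruxes/GrenetFirstOrderRankRigid/Lines/grenet_gauge.lean` (blueprint
`Lines/grenet_gauge-stub_linearRigid-PROOF.md`, §3).  The tangency functional of the stub is
`x̃' ↦ tr(adj(x̃) · x̃')` for Grenet's matrix `x̃ = Grenet.repr k n e`; this file computes `adj(x̃)`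
EXPLICITLY in terms of the lattice-path matrix `W := adj(1 - adj) = (1 - adj)⁻¹` of Grenet's
branching program (`W S T` = sum over the lattice paths `S → T` of the products of the arc
variables; `W ∅ univ = per_n`):

  `adj(x̃) j i = ε · ( per_n · W (C j) (R i) - W (C j) univ · W ∅ (R i) )`,

`ε = (-1)^(e univ + e ∅)`, `R i = e⁻¹((e univ).succAbove i) ≠ univ` the vertex of row `i`,
`C j = e⁻¹((e ∅).succAbove j) ≠ ∅` the vertex of column `j` (`grenet_adjugate_repr`).  Proof: the
displayed matrix `Z` satisfies `x̃ · Z = per_n · 1` (`(1 - adj) · W = 1`, the row of `univ` of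
`1 - adj` is absent from `x̃`, and the column-`∅` correction vanishes because `W ∅ univ = per_n`), while
`x̃ · adj x̃ = det x̃ · 1 = per_n · 1`; cancelling `x̃` (multiply by `adj x̃` on the left; `per_n ≠ 0` is
not a zero divisor) gives `Z = adj x̃`.  Consequently, for every matrix `N`,
`tr(adj(x̃) · N) = ε · Σ_{i,j} (per_n · W (C j) (R i) - W (C j) univ · W ∅ (R i)) · N i j`
(`trace_grenet_adjugate_mul`) — Jacobi's complementary-minor formula for the unimodular `1 - adj`
in the form the weight-block analysis of the blueprint consumes ("a closed walk through the new
entry, times `per_n`, minus a path `∅ → univ` through the new entry").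

Main statements: `grenet_one_sub_adj_mul_W`, `grenet_W_empty_univ`, `grenet_pathCofactor_sum`,
`grenet_repr_mul_pathCofactor`, `grenet_adjugate_repr`, `trace_grenet_adjugate_mul`.  No new
definitions (`W` is written `(1 - Grenet.adj k n).adjugate`).  VP ≠ VNP is not moved by this file
(bookkeeping for a first-order statement about one explicit matrix family).
-/

noncomputable section

open MvPolynomial Matrix Finset

namespace Summit.ValiantsHypothesis.Theorems.RigidityForcesSymmetry.GrenetGauge

open Literature.Computability.AlgebraicComplexity

section PathMatrix

variable (k : Type*) [CommRing k] (n : ℕ)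

/-- Grenet's adjacency matrix in the shape consumed by the path calculus of
`PermanentVsDeterminantProofs`. [cite: Grenet2011, Thm. 1] -/
theorem grenet_adj_shape (S T : Finset (Fin n)) :
    Grenet.adj k n S T = ∑ j, if j ∉ S ∧ T = insert j S then Grenet.wt k n j S.card else 0 := rfl

/-- `1 - adj` is unimodular: `det (1 - adj) = 1`. [cite: Grenet2011, Thm. 1] -/
theorem grenet_det_one_sub_adj : (1 - Grenet.adj k n).det = 1 :=
  Grenet.det_one_sub (Grenet.wt k n) (grenet_adj_shape k n)

/-- The path matrix `W = adj(1 - adj)` is a right inverse of `1 - adj`. [folklore] -/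
theorem grenet_one_sub_adj_mul_W : (1 - Grenet.adj k n) * (1 - Grenet.adj k n).adjugate = 1 := by
  rw [Matrix.mul_adjugate, grenet_det_one_sub_adj, one_smul]

/-- The path matrix `W = adj(1 - adj)` is a left inverse of `1 - adj`. [folklore] -/
theorem grenet_W_mul_one_sub_adj : (1 - Grenet.adj k n).adjugate * (1 - Grenet.adj k n) = 1 := by
  rw [Matrix.adjugate_mul, grenet_det_one_sub_adj, one_smul]

/-- Entrywise form of `(1 - adj) · W = 1`. [folklore] -/
theorem grenet_one_sub_adj_mul_W_apply (S T : Finset (Fin n)) :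
    ∑ U, (1 - Grenet.adj k n) S U * (1 - Grenet.adj k n).adjugate U T = if S = T then 1 else 0 := by
  have h := congrFun (congrFun (grenet_one_sub_adj_mul_W k n) S) T
  rwa [Matrix.mul_apply, Matrix.one_apply] at h

/-- **The `(∅, univ)` entry of the path matrix is the permanent**: `W ∅ univ = per_n`
(the full paths of the branching program are the `n!` monomials of `per_n`). [cite: Grenet2011, Thm. 1] -/
theorem grenet_W_empty_univ : (1 - Grenet.adj k n).adjugate ∅ univ = perPoly (Fin n) k := by
  rw [Grenet.adjugate_one_sub_empty_univ (Grenet.wt k n) (grenet_adj_shape k n),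
    Grenet.sum_ite_injective, perPoly, Matrix.permanent]
  refine Finset.sum_congr rfl fun σ _ => Finset.prod_congr rfl fun t _ => ?_
  have hwX : ∀ (j : Fin n) (c : Fin n), Grenet.wt k n j c = X (j, c) := fun j c => by simp [Grenet.wt]
  rw [hwX, Matrix.mvPolynomialX_apply]

/-- **The path-cofactor identity**, summed over all vertices: for `S ≠ univ`,
`Σ_T (1 - adj) S T · (per_n · W T S' - W T univ · W ∅ S') = per_n · [S = S']`
(distribute and use `(1 - adj) · W = 1` twice). [folklore] -/
theorem grenet_pathCofactor_sum {S : Finset (Fin n)} (hS : S ≠ univ) (S' : Finset (Fin n)) :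
    ∑ T, (1 - Grenet.adj k n) S T *
        (perPoly (Fin n) k * (1 - Grenet.adj k n).adjugate T S'
          - (1 - Grenet.adj k n).adjugate T univ * (1 - Grenet.adj k n).adjugate ∅ S')
      = if S = S' then perPoly (Fin n) k else 0 := by
  have h1 : ∀ T, (1 - Grenet.adj k n) S T *
        (perPoly (Fin n) k * (1 - Grenet.adj k n).adjugate T S'
          - (1 - Grenet.adj k n).adjugate T univ * (1 - Grenet.adj k n).adjugate ∅ S')
      = perPoly (Fin n) k * ((1 - Grenet.adj k n) S T * (1 - Grenet.adj k n).adjugate T S')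
        - ((1 - Grenet.adj k n) S T * (1 - Grenet.adj k n).adjugate T univ) * (1 - Grenet.adj k n).adjugate ∅ S' :=
    fun T => by ring
  simp only [h1, Finset.sum_sub_distrib, ← Finset.mul_sum, ← Finset.sum_mul,
    grenet_one_sub_adj_mul_W_apply, if_neg hS, zero_mul, sub_zero]
  split_ifs <;> simp

/-- The `T = ∅` term of the path-cofactor sum vanishes, because `W ∅ univ = per_n`. [folklore] -/
theorem grenet_pathCofactor_empty (S S' : Finset (Fin n)) :
    (1 - Grenet.adj k n) S ∅ *
        (perPoly (Fin n) k * (1 - Grenet.adj k n).adjugate ∅ S'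
          - (1 - Grenet.adj k n).adjugate ∅ univ * (1 - Grenet.adj k n).adjugate ∅ S') = 0 := by
  rw [grenet_W_empty_univ, sub_self, mul_zero]

end PathMatrix

section Adjugate

variable {k : Type*} [CommRing k] {n N : ℕ} (e : Finset (Fin n) ≃ Fin (N + 1))

/-- Entries of Grenet's matrix: `x̃ i j = ε · (1 - adj) (R i) (C j)`. [cite: Grenet2011, Thm. 1] -/
theorem grenet_repr_apply (i j : Fin N) :
    Grenet.repr k n e i j = (-1) ^ ((e univ : ℕ) + (e ∅ : ℕ)) *
      (1 - Grenet.adj k n) (e.symm ((e univ).succAbove i)) (e.symm ((e ∅).succAbove j)) := by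
  rw [Grenet.repr, Matrix.smul_apply, Matrix.submatrix_apply, Matrix.submatrix_apply, smul_eq_mul]

/-- Summing over the column vertices `C j`, `j : Fin N`, is summing over the nonempty subsets:
`Σ_j f (C j) = Σ_T f T - f ∅`. [folklore] -/
theorem sum_grenet_col {M : Type*} [AddCommGroup M] (f : Finset (Fin n) → M) :
    ∑ j : Fin N, f (e.symm ((e ∅).succAbove j)) = ∑ T, f T - f ∅ := by
  have h := Fin.sum_univ_succAbove (fun x : Fin (N + 1) => f (e.symm x)) (e ∅)
  simp only [e.symm_apply_apply] at h
  rw [Equiv.sum_comp e.symm f] at h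
  rw [h, add_sub_cancel_left]

/-- Summing over the row vertices `R i`, `i : Fin N`, is summing over the proper subsets:
`Σ_i f (R i) = Σ_S f S - f univ`. [folklore] -/
theorem sum_grenet_row {M : Type*} [AddCommGroup M] (f : Finset (Fin n) → M) :
    ∑ i : Fin N, f (e.symm ((e univ).succAbove i)) = ∑ S, f S - f univ := by
  have h := Fin.sum_univ_succAbove (fun x : Fin (N + 1) => f (e.symm x)) (e univ)
  simp only [e.symm_apply_apply] at h
  rw [Equiv.sum_comp e.symm f] at h
  rw [h, add_sub_cancel_left]

/-- The sign `ε = (-1)^(e univ + e ∅)` squares to one. [folklore] -/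
theorem grenet_sign_mul_self :
    (-1 : MvPolynomial (Fin n × Fin n) k) ^ ((e univ : ℕ) + (e ∅ : ℕ)) * (-1) ^ ((e univ : ℕ) + (e ∅ : ℕ)) = 1 := by
  rw [← mul_pow, neg_one_mul, neg_neg, one_pow]

/-- **The path-cofactor matrix is a right quasi-inverse of Grenet's matrix**: with
`Z j i := ε · (per_n · W (C j) (R i) - W (C j) univ · W ∅ (R i))`, `x̃ · Z = per_n · 1`. [folklore] -/
theorem grenet_repr_mul_pathCofactor :
    Grenet.repr k n e * (Matrix.of fun j i => (-1 : MvPolynomial (Fin n × Fin n) k) ^ ((e univ : ℕ) + (e ∅ : ℕ)) *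
        (perPoly (Fin n) k * (1 - Grenet.adj k n).adjugate (e.symm ((e ∅).succAbove j)) (e.symm ((e univ).succAbove i))
          - (1 - Grenet.adj k n).adjugate (e.symm ((e ∅).succAbove j)) univ
            * (1 - Grenet.adj k n).adjugate ∅ (e.symm ((e univ).succAbove i))))
      = perPoly (Fin n) k • (1 : Matrix (Fin N) (Fin N) (MvPolynomial (Fin n × Fin n) k)) := by
  refine Matrix.ext fun i i' => ?_
  have key : ∀ a b : MvPolynomial (Fin n × Fin n) k,
      (-1 : MvPolynomial (Fin n × Fin n) k) ^ ((e univ : ℕ) + (e ∅ : ℕ)) * a *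
        ((-1) ^ ((e univ : ℕ) + (e ∅ : ℕ)) * b) = a * b := fun a b => by
    rw [mul_mul_mul_comm, grenet_sign_mul_self, one_mul]
  rw [Matrix.mul_apply, Matrix.smul_apply, Matrix.one_apply]
  simp only [Matrix.of_apply, grenet_repr_apply, key]
  have h : ∑ j : Fin N, (1 - Grenet.adj k n) (e.symm ((e univ).succAbove i)) (e.symm ((e ∅).succAbove j)) *
      (perPoly (Fin n) k * (1 - Grenet.adj k n).adjugate (e.symm ((e ∅).succAbove j)) (e.symm ((e univ).succAbove i'))
        - (1 - Grenet.adj k n).adjugate (e.symm ((e ∅).succAbove j)) univ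
          * (1 - Grenet.adj k n).adjugate ∅ (e.symm ((e univ).succAbove i')))
      = ∑ T, (1 - Grenet.adj k n) (e.symm ((e univ).succAbove i)) T *
          (perPoly (Fin n) k * (1 - Grenet.adj k n).adjugate T (e.symm ((e univ).succAbove i'))
            - (1 - Grenet.adj k n).adjugate T univ * (1 - Grenet.adj k n).adjugate ∅ (e.symm ((e univ).succAbove i')))
        - (1 - Grenet.adj k n) (e.symm ((e univ).succAbove i)) ∅ *
          (perPoly (Fin n) k * (1 - Grenet.adj k n).adjugate ∅ (e.symm ((e univ).succAbove i'))
            - (1 - Grenet.adj k n).adjugate ∅ univ * (1 - Grenet.adj k n).adjugate ∅ (e.symm ((e univ).succAbove i'))) :=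
    sum_grenet_col e (fun T => (1 - Grenet.adj k n) (e.symm ((e univ).succAbove i)) T *
      (perPoly (Fin n) k * (1 - Grenet.adj k n).adjugate T (e.symm ((e univ).succAbove i'))
        - (1 - Grenet.adj k n).adjugate T univ * (1 - Grenet.adj k n).adjugate ∅ (e.symm ((e univ).succAbove i'))))
  rw [h, grenet_pathCofactor_sum k n (grenet_row_ne_univ e i), grenet_pathCofactor_empty, sub_zero]
  have hRR : (e.symm ((e univ).succAbove i) = e.symm ((e univ).succAbove i')) ↔ i = i' :=
    ⟨fun h => Fin.succAbove_right_injective (e.symm.injective h), fun h => by rw [h]⟩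
  by_cases hii : i = i'
  · rw [if_pos (hRR.mpr hii), if_pos hii, smul_eq_mul, mul_one]
  · rw [if_neg (fun h => hii (hRR.mp h)), if_neg hii, smul_zero]

/-- **The adjugate of Grenet's matrix in path form** (Jacobi's complementary minors for the
unimodular `1 - adj`): `adj(x̃) j i = ε · (per_n · W (C j) (R i) - W (C j) univ · W ∅ (R i))` with
`W = adj(1 - adj)` the lattice-path matrix, `R i`/`C j` the row/column vertices and
`ε = (-1)^(e univ + e ∅)`.  (From `x̃ · Z = per_n · 1 = x̃ · adj x̃` and `adj x̃ · x̃ = per_n · 1`,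
`per_n ≠ 0` being a non-zero-divisor.) [cite: Grenet2011, Thm. 1] -/
theorem grenet_adjugate_repr [IsDomain k] (hn : n ≠ 0) (hN : 2 ^ n = N + 1) (j i : Fin N) :
    (Grenet.repr k n e).adjugate j i = (-1 : MvPolynomial (Fin n × Fin n) k) ^ ((e univ : ℕ) + (e ∅ : ℕ)) *
      (perPoly (Fin n) k * (1 - Grenet.adj k n).adjugate (e.symm ((e ∅).succAbove j)) (e.symm ((e univ).succAbove i))
        - (1 - Grenet.adj k n).adjugate (e.symm ((e ∅).succAbove j)) univ
          * (1 - Grenet.adj k n).adjugate ∅ (e.symm ((e univ).succAbove i))) := by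
  set Z : Matrix (Fin N) (Fin N) (MvPolynomial (Fin n × Fin n) k) := Matrix.of fun j i =>
    (-1 : MvPolynomial (Fin n × Fin n) k) ^ ((e univ : ℕ) + (e ∅ : ℕ)) *
      (perPoly (Fin n) k * (1 - Grenet.adj k n).adjugate (e.symm ((e ∅).succAbove j)) (e.symm ((e univ).succAbove i))
        - (1 - Grenet.adj k n).adjugate (e.symm ((e ∅).succAbove j)) univ
          * (1 - Grenet.adj k n).adjugate ∅ (e.symm ((e univ).succAbove i))) with hZ
  have hdet : (Grenet.repr k n e).det = perPoly (Fin n) k := (Grenet.isAffineDetRepr_repr k n hn hN e).2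
  have h1 : Grenet.repr k n e * Z = Grenet.repr k n e * (Grenet.repr k n e).adjugate := by
    rw [hZ, grenet_repr_mul_pathCofactor, Matrix.mul_adjugate, hdet]
  have h2 : perPoly (Fin n) k • (Z - (Grenet.repr k n e).adjugate) = 0 := by
    have h3 : Grenet.repr k n e * (Z - (Grenet.repr k n e).adjugate) = 0 := by
      rw [Matrix.mul_sub, h1, sub_self]
    have h4 := congrArg (fun X => (Grenet.repr k n e).adjugate * X) h3
    rwa [← Matrix.mul_assoc, Matrix.adjugate_mul, hdet, Matrix.smul_mul, Matrix.one_mul,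
      Matrix.mul_zero] at h4
  have h5 : perPoly (Fin n) k * (Z j i - (Grenet.repr k n e).adjugate j i) = 0 := by
    have := congrFun (congrFun h2 j) i
    rwa [Matrix.smul_apply, Matrix.sub_apply, smul_eq_mul, Matrix.zero_apply] at this
  have h6 := (mul_eq_zero.mp h5).resolve_left (perPoly_ne_zero (Fin n) k)
  rw [sub_eq_zero] at h6
  rw [← h6, hZ, Matrix.of_apply]

/-- **The tangency functional of the line `grenet_gauge` in path form**: for every matrix `N`,
`tr(adj(x̃) · N) = ε · Σ_i Σ_j (per_n · W (C j) (R i) - W (C j) univ · W ∅ (R i)) · N i j`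
("`per_n ×` the closed walks `C j → R i ⇝ C j` through the entry `(i, j)`, minus the paths
`∅ → R i ⇝ C j → univ` through it"). [cite: Grenet2011, Thm. 1] -/
theorem trace_grenet_adjugate_mul [IsDomain k] (hn : n ≠ 0) (hN : 2 ^ n = N + 1)
    (N' : Matrix (Fin N) (Fin N) (MvPolynomial (Fin n × Fin n) k)) :
    ((Grenet.repr k n e).adjugate * N').trace = (-1 : MvPolynomial (Fin n × Fin n) k) ^ ((e univ : ℕ) + (e ∅ : ℕ)) *
      ∑ i, ∑ j, (perPoly (Fin n) k * (1 - Grenet.adj k n).adjugate (e.symm ((e ∅).succAbove j)) (e.symm ((e univ).succAbove i))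
        - (1 - Grenet.adj k n).adjugate (e.symm ((e ∅).succAbove j)) univ
          * (1 - Grenet.adj k n).adjugate ∅ (e.symm ((e univ).succAbove i))) * N' i j := by
  rw [Matrix.trace]
  simp only [Matrix.diag, Matrix.mul_apply, grenet_adjugate_repr e hn hN]
  rw [Finset.sum_comm, Finset.mul_sum]
  refine Finset.sum_congr rfl fun i _ => ?_
  rw [Finset.mul_sum]
  refine Finset.sum_congr rfl fun j _ => ?_
  ring

end Adjugate

end Summit.ValiantsHypothesis.Theorems.RigidityForcesSymmetry.GrenetGauge
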